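import Summits.HodgeConjecture.HodgeConjecture.Theorems.K2E4WeakMatrixArchTransportOfRay     -- ★ p854807 (this seat): ray transport at `∞`, frame imports (`ArchSmooth₂`, `IsArchDeltaTransfer`, `archCanonicalTransferFactor`, …)
import Summits.HodgeConjecture.HodgeConjecture.Theorems.K2E4WeakMatrixFiniteTransportOfRay   -- ★ p854914 (this seat): ray transport at finite `v` (`IsLocSmooth`, `IsLocalDeltaTransfer`, `finExplicitCollection`, …)
import Literature.NumberTheory.Rogawski1990.LocalTransferAtOneMuTwist                     -- ★ `stableOrbitalIntegralRel_mul_of_forall_eq` (a stable-class-function multiplier comes out of `Φ^st`)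
import HarnessLib

/-!
# K2 · E4 helper — (κ) TRANSPORT UNDER A CLASS-FUNCTION TWIST OF THE TRANSFER FACTOR («sockets #21 ∕ #22 modulo the twist lemma (T)»)

Cell `pub/hodgecm-mathlib`, Track B «K2-LIT», seat `hodgecm-mathlib-K2E4-p21` (g0) (offer 21:3xZ on the K2 bus); crux H413 = `stmt-HodgeConjecture-24833` (supports-only
helper, count-neutral).  THEOREMS ONLY (no definition, no instance, no notation, no named fact, no `sorry`).  Generalises this seat's two RAY helpers (★
`K2E4WeakMatrixArchTransportOfRay`, ★ `K2E4WeakMatrixFiniteTransportOfRay`: constant `c`) to a TWIST by a class function `ψ(γ_H)`.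

WHY.  The U1 sockets #21 `sig_K2E4WeakMatrixArchTransport` ∕ #22 `sig_K2E4WeakMatrixFiniteTransport` (NOT IN PRINT) transport the singular κ-transfer statements
(κ-arch) ∕ (κ-loc)_v from Rogawski's explicit factor `Δ‴` to a WEAK factor of the letters' matrices.  The refuter's analysis (K2E4-r01 (g0), `K2/K2E4-r01/g0/U1-FALSIFIER…md`,
K2 bus 21:33:57Z) and this seat's census agree on the mechanism: every weak factor the matrices admit that anyone can write down is a TWIST `Δ = ψ(γ_H) · Δ‴` by a
nowhere-zero class function `ψ` of `γ_H` (locally constant at finite `v`; smooth at `∞`; automorphic characters `χ∘det`, place constants, r01's compensated phase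
twists), and under such a twist the κ-statements transport with the constant moved by `ψ` at the singular point — «#21 ∕ #22 survive, true modulo the local twist
lemma (T)».  THIS FILE is that transport, with (T) isolated as its only non-bookkeeping input: given `T.Δ(γ_H, ·) = ψ(γ_H) · T′.Δ(γ_H, ·)` at the `G`-regular `γ_H` and a
multiplier `ρ` that is conjugation-invariant, constant on the stable classes of `G`-regular elements and inverts `ψ` there (`ρ · ψ = 1` on the `G`-regular set; `ρ` is
free elsewhere, in particular AT the singular point), the pair `(ρ · f^H, f)` is a `T′`-pair whenever `(f^H, f)` is a `T`-pair (★ `stableOrbitalIntegralRel_mul_of_forall_eq`: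
`Φ^st(γ_H, ρ · f^H) = ρ(γ_H) · Φ^st(γ_H, f^H)`), so (κ)[T′, κ₁] ⟹ (κ)[T, κ₁ · ρ(x₀)] PROVIDED the test class is closed under `f^H ↦ ρ · f^H` — which at a finite place is
a theorem for locally constant `ρ` (`IsLocSmooth` = locally constant ∧ compact support) and at `∞` is the hypothesis (T∞) «`ArchSmooth₂` is closed under multiplication by
`ρ`» (smooth extension off the closed subgroup `ι_∞(H_∞) ≤ GL₃(L ⊗ ℝ)` in the tree's `IsArchSmooth` currency — not proved here).

* §1 (abstract (4.3.1)) `isDeltaTransferRel_mul_of_delta_eq_classFun_mul`, **`kappaTransport_of_delta_eq_classFun_mul`**.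
* §2 (`∞`) **`archKappaTransport_of_delta_eq_classFun_mul`** (hypothesis (T∞)), **`weakMatrixArchTransport_of_twist`** (socket #21's `(Hcan) → (Hweak)` with its
  functional and point verbatim, modulo the twist data and (T∞)).
* §3 (finite `v`) **`finKappaTransport_of_delta_eq_classFun_mul`** ((T_v) DISCHARGED for locally constant `ρ`), **`weakMatrixFiniteTransport_of_twist`** (socket #22's
  per-place implication verbatim, modulo the twist data only).

HONEST LABEL: HC_CM is proved only modulo the 7 printed citations (2 remaining named inputs: hLiu418 = stmt-HodgeConjecture-24832, h413 = stmt-HodgeConjecture-24833)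
until rung 0 closes; this file proves no printed statement and pays neither socket (the weak case still needs «every admissible weak factor IS such a twist», the
rigidity content of U1).

## References
* [Rogawski1990] J. D. Rogawski, *Automorphic Representations of Unitary Groups in Three Variables*, Ann. of Math. Stud. 123 (1990): §4.1 (4.1.1) p. 39; §4.3 (4.3.1)
  p. 43; §4.9 Prop. 4.9.1 (a) p. 55 (`μ` enters `Δ` through `τ(γ_H)` only); §8.2 Prop. 8.2.1 (a) p. 118; §14.3 pp. 233–234; §14.6 p. 242.
* [LanglandsShelstad1987] R. P. Langlands, D. Shelstad, On the definition of transfer factors, Math. Ann. 278 (1987), §4.2 (dependence on the endoscopic character).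
-/

set_option autoImplicit false
set_option linter.dupNamespace false

noncomputable section

open MeasureTheory Measure NumberField IsDedekindDomain
open Literature.NumberTheory.Rogawski1990 Literature.NumberTheory.Automorphic Literature.NumberTheory.GaloisRepresentations
open scoped Matrix MatrixGroups

namespace Summit.HodgeConjecture.HodgeConjecture.Cruxes.H413.K2E4WeakMatrixTransportOfTwist

/-! ## §1 Abstract: (4.3.1) under a class-function twist of the factor -/

section Abstract

variable {A B : Type*} [Group A] [Group B]
  [∀ a : A, MeasurableSpace (A ⧸ Subgroup.centralizer ({a} : Set A))]
  [∀ b : B, MeasurableSpace (B ⧸ Subgroup.centralizer ({b} : Set B))]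

/-- **(4.3.1) under a class-function twist**: if `Δ_T(γ_H, ·) = ψ(γ_H) · Δ_{T′}(γ_H, ·)` at the `G`-regular `γ_H`, `ρ` is conjugation-invariant, constant on the
stable class of every `G`-regular `γ_H` and `ρ · ψ = 1` there, then `f → f^H` for `T` implies `f → ρ · f^H` for `T′` (★ `stableOrbitalIntegralRel_mul_of_forall_eq`,
Mathlib `mul_finsum`). [cite: Rogawski1990, §4.3 (4.3.1) p. 43; §4.9 Prop. 4.9.1 (a) p. 55] [cite: LanglandsShelstad1987, §4.2] -/
theorem isDeltaTransferRel_mul_of_delta_eq_classFun_mul {R : A → B → Prop} {stA : A → A → Prop} {regA : A → Prop}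
    {T T' : TransferFactorData A B R} {mH : OrbitalMeasureFamily A} {mG : OrbitalMeasureFamily B} {fH : A → ℂ} {f : B → ℂ}
    (ψ ρ : A → ℂ) (hρc : ∀ g x : A, ρ (g * x * g⁻¹) = ρ x) (hρs : ∀ a b : A, regA a → stA a b → ρ b = ρ a)
    (hρψ : ∀ a : A, regA a → ρ a * ψ a = 1) (hT : ∀ (a : A) (b : B), regA a → T.Δ a b = ψ a * T'.Δ a b)
    (h : IsDeltaTransferRel R stA regA T mH mG fH f) :
    IsDeltaTransferRel R stA regA T' mH mG (fun y => ρ y * fH y) f := by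
  intro a ha
  rw [stableOrbitalIntegralRel_mul_of_forall_eq stA mH ρ fH a hρc (fun b hb => hρs a b ha hb), h a ha, mul_finsum]
  exact finsum_congr fun x => by rw [hT a _ ha, ← mul_assoc, ← mul_assoc, hρψ a ha, one_mul]

/-- **κ-TRANSPORT under a class-function twist, abstract form**: with the data of `isDeltaTransferRel_mul_of_delta_eq_classFun_mul`, a test class `Smooth_H` closed
under `f^H ↦ ρ · f^H`, and `ρ(x₀) ≠ 0`, «`F f = κ₁ · f^H(x₀)` for every `T′`-pair» implies «`F f = (κ₁ ρ(x₀)) · f^H(x₀)` for every `T`-pair», for ANY functional `F` of `f`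
and ANY point `x₀` (the pair `(ρ · f^H, f)` is a `T′`-pair). [cite: Rogawski1990, §4.3 (4.3.1) p. 43; Prop. 8.2.1 (a) p. 118] -/
theorem kappaTransport_of_delta_eq_classFun_mul {R : A → B → Prop} {stA : A → A → Prop} {regA : A → Prop}
    {T T' : TransferFactorData A B R} {mH : OrbitalMeasureFamily A} {mG : OrbitalMeasureFamily B}
    (ψ ρ : A → ℂ) (hρc : ∀ g x : A, ρ (g * x * g⁻¹) = ρ x) (hρs : ∀ a b : A, regA a → stA a b → ρ b = ρ a)
    (hρψ : ∀ a : A, regA a → ρ a * ψ a = 1) (hT : ∀ (a : A) (b : B), regA a → T.Δ a b = ψ a * T'.Δ a b)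
    (SmoothG : (B → ℂ) → Prop) (SmoothH : (A → ℂ) → Prop) (hH : ∀ fH : A → ℂ, SmoothH fH → SmoothH (fun y => ρ y * fH y))
    (F : (B → ℂ) → ℂ) {x₀ : A} (hx₀ : ρ x₀ ≠ 0) {κ₁ : ℂ} (hκ₁ : κ₁ ≠ 0)
    (h : ∀ (fH : A → ℂ) (f : B → ℂ), SmoothG f → SmoothH fH → IsDeltaTransferRel R stA regA T' mH mG fH f → F f = κ₁ * fH x₀) :
    ∃ κ : ℂ, κ ≠ 0 ∧
      ∀ (fH : A → ℂ) (f : B → ℂ), SmoothG f → SmoothH fH → IsDeltaTransferRel R stA regA T mH mG fH f → F f = κ * fH x₀ := by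
  refine ⟨κ₁ * ρ x₀, mul_ne_zero hκ₁ hx₀, fun fH f hf hfH hrel => ?_⟩
  have key := h (fun y => ρ y * fH y) f hf (hH fH hfH) (isDeltaTransferRel_mul_of_delta_eq_classFun_mul ψ ρ hρc hρs hρψ hT hrel)
  rw [key, mul_assoc]

end Abstract

/-! ## §2 At `∞`: `H_∞ = U(Φ₂)(L⁺ ⊗ ℝ) × U(Φ₁)(L⁺ ⊗ ℝ)`, `G′_∞ = U(H′)(L⁺ ⊗ ℝ)`; (T∞) is a hypothesis -/

section Arch

variable (L : Type) [Field L] [NumberField L] [IsCMField L] (H' : Matrix (Fin 3) (Fin 3) L)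

/-- **κ-TRANSPORT under a class-function twist at `∞`** (any functional ∕ point): archimedean transfer factors `T, T′` with `T.Δ(γ_H, γ′) = ψ(γ_H) · T′.Δ(γ_H, γ′)` at the
`G`-regular `γ_H ∈ H_∞`; `ρ` conjugation-invariant on `H_∞`, constant on the stable classes (★ `IsArchStablyConjH`) of `G`-regular elements, `ρ · ψ = 1` there, `ρ(x₀) ≠ 0`;
(T∞) `C_c^∞(H_∞)` (★ `ArchSmooth₂`) closed under `a^H ↦ ρ · a^H`.  Then (κ-arch)[T′, cinf₁] ⟹ (κ-arch)[T, cinf₁ · ρ(x₀)].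
[cite: Rogawski1990, §14.3 pp. 233–234; Prop. 8.2.1 (a) p. 118; §4.9 p. 55] [cite: LanglandsShelstad1987, §4.2] -/
theorem archKappaTransport_of_delta_eq_classFun_mul
    {_ha : ∀ a : (UnitaryGroup.arch (↥(maximalRealSubfield L)) L (IsCMField.complexConj L) 2
          (Matrix.of fun i j : Fin 2 => if i.val + j.val + 1 = 2 then (1 : L) else 0) ×
        UnitaryGroup.arch (↥(maximalRealSubfield L)) L (IsCMField.complexConj L) 1
          (Matrix.of fun i j : Fin 1 => if i.val + j.val + 1 = 1 then (1 : L) else 0)),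
      MeasurableSpace ((UnitaryGroup.arch (↥(maximalRealSubfield L)) L (IsCMField.complexConj L) 2
          (Matrix.of fun i j : Fin 2 => if i.val + j.val + 1 = 2 then (1 : L) else 0) ×
        UnitaryGroup.arch (↥(maximalRealSubfield L)) L (IsCMField.complexConj L) 1
          (Matrix.of fun i j : Fin 1 => if i.val + j.val + 1 = 1 then (1 : L) else 0)) ⧸
        Subgroup.centralizer ({a} : Set (UnitaryGroup.arch (↥(maximalRealSubfield L)) L (IsCMField.complexConj L) 2
          (Matrix.of fun i j : Fin 2 => if i.val + j.val + 1 = 2 then (1 : L) else 0) ×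
        UnitaryGroup.arch (↥(maximalRealSubfield L)) L (IsCMField.complexConj L) 1
          (Matrix.of fun i j : Fin 1 => if i.val + j.val + 1 = 1 then (1 : L) else 0))))}
    {_hγ : ∀ γ : UnitaryGroup.arch (↥(maximalRealSubfield L)) L (IsCMField.complexConj L) 3 H',
      MeasurableSpace (UnitaryGroup.arch (↥(maximalRealSubfield L)) L (IsCMField.complexConj L) 3 H' ⧸
        Subgroup.centralizer ({γ} : Set (UnitaryGroup.arch (↥(maximalRealSubfield L)) L (IsCMField.complexConj L) 3 H')))}
    {T T' : ArchTransferFactor L H'} (ψ ρ : (UnitaryGroup.arch (↥(maximalRealSubfield L)) L (IsCMField.complexConj L) 2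
          (Matrix.of fun i j : Fin 2 => if i.val + j.val + 1 = 2 then (1 : L) else 0) ×
        UnitaryGroup.arch (↥(maximalRealSubfield L)) L (IsCMField.complexConj L) 1
          (Matrix.of fun i j : Fin 1 => if i.val + j.val + 1 = 1 then (1 : L) else 0)) → ℂ)
    (hρc : ∀ g x : (UnitaryGroup.arch (↥(maximalRealSubfield L)) L (IsCMField.complexConj L) 2
          (Matrix.of fun i j : Fin 2 => if i.val + j.val + 1 = 2 then (1 : L) else 0) ×
        UnitaryGroup.arch (↥(maximalRealSubfield L)) L (IsCMField.complexConj L) 1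
          (Matrix.of fun i j : Fin 1 => if i.val + j.val + 1 = 1 then (1 : L) else 0)), ρ (g * x * g⁻¹) = ρ x)
    (hρs : ∀ a b : (UnitaryGroup.arch (↥(maximalRealSubfield L)) L (IsCMField.complexConj L) 2
          (Matrix.of fun i j : Fin 2 => if i.val + j.val + 1 = 2 then (1 : L) else 0) ×
        UnitaryGroup.arch (↥(maximalRealSubfield L)) L (IsCMField.complexConj L) 1
          (Matrix.of fun i j : Fin 1 => if i.val + j.val + 1 = 1 then (1 : L) else 0)), IsArchGRegular L a → IsArchStablyConjH L a b → ρ b = ρ a)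
    (hρψ : ∀ a : (UnitaryGroup.arch (↥(maximalRealSubfield L)) L (IsCMField.complexConj L) 2
          (Matrix.of fun i j : Fin 2 => if i.val + j.val + 1 = 2 then (1 : L) else 0) ×
        UnitaryGroup.arch (↥(maximalRealSubfield L)) L (IsCMField.complexConj L) 1
          (Matrix.of fun i j : Fin 1 => if i.val + j.val + 1 = 1 then (1 : L) else 0)), IsArchGRegular L a → ρ a * ψ a = 1)
    (hT : ∀ (γH : (UnitaryGroup.arch (↥(maximalRealSubfield L)) L (IsCMField.complexConj L) 2
          (Matrix.of fun i j : Fin 2 => if i.val + j.val + 1 = 2 then (1 : L) else 0) ×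
        UnitaryGroup.arch (↥(maximalRealSubfield L)) L (IsCMField.complexConj L) 1
          (Matrix.of fun i j : Fin 1 => if i.val + j.val + 1 = 1 then (1 : L) else 0)))
        (γ' : UnitaryGroup.arch (↥(maximalRealSubfield L)) L (IsCMField.complexConj L) 3 H'),
        IsArchGRegular L γH → T.Δ γH γ' = ψ γH * T'.Δ γH γ')
    (hTinfty : ∀ aH : (UnitaryGroup.arch (↥(maximalRealSubfield L)) L (IsCMField.complexConj L) 2
          (Matrix.of fun i j : Fin 2 => if i.val + j.val + 1 = 2 then (1 : L) else 0) ×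
        UnitaryGroup.arch (↥(maximalRealSubfield L)) L (IsCMField.complexConj L) 1
          (Matrix.of fun i j : Fin 1 => if i.val + j.val + 1 = 1 then (1 : L) else 0)) → ℂ, ArchSmooth₂ L aH → ArchSmooth₂ L (fun y => ρ y * aH y))
    (mHi : OrbitalMeasureFamily (UnitaryGroup.arch (↥(maximalRealSubfield L)) L (IsCMField.complexConj L) 2
          (Matrix.of fun i j : Fin 2 => if i.val + j.val + 1 = 2 then (1 : L) else 0) ×
        UnitaryGroup.arch (↥(maximalRealSubfield L)) L (IsCMField.complexConj L) 1
          (Matrix.of fun i j : Fin 1 => if i.val + j.val + 1 = 1 then (1 : L) else 0)))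
    (m' : OrbitalMeasureFamily (UnitaryGroup.arch (↥(maximalRealSubfield L)) L (IsCMField.complexConj L) 3 H'))
    (F : (UnitaryGroup.arch (↥(maximalRealSubfield L)) L (IsCMField.complexConj L) 3 H' → ℂ) → ℂ)
    {x₀ : (UnitaryGroup.arch (↥(maximalRealSubfield L)) L (IsCMField.complexConj L) 2
          (Matrix.of fun i j : Fin 2 => if i.val + j.val + 1 = 2 then (1 : L) else 0) ×
        UnitaryGroup.arch (↥(maximalRealSubfield L)) L (IsCMField.complexConj L) 1
          (Matrix.of fun i j : Fin 1 => if i.val + j.val + 1 = 1 then (1 : L) else 0))} (hx₀ : ρ x₀ ≠ 0) {cinf₁ : ℂ} (h₁ : cinf₁ ≠ 0)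
    (h : ∀ (aH : (UnitaryGroup.arch (↥(maximalRealSubfield L)) L (IsCMField.complexConj L) 2
          (Matrix.of fun i j : Fin 2 => if i.val + j.val + 1 = 2 then (1 : L) else 0) ×
        UnitaryGroup.arch (↥(maximalRealSubfield L)) L (IsCMField.complexConj L) 1
          (Matrix.of fun i j : Fin 1 => if i.val + j.val + 1 = 1 then (1 : L) else 0)) → ℂ)
        (a : UnitaryGroup.arch (↥(maximalRealSubfield L)) L (IsCMField.complexConj L) 3 H' → ℂ),
        ArchSmooth L 3 H' a → ArchSmooth₂ L aH → IsArchDeltaTransfer L H' T' mHi m' aH a → F a = cinf₁ * aH x₀) :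
    ∃ cinf : ℂ, cinf ≠ 0 ∧
      ∀ (aH : (UnitaryGroup.arch (↥(maximalRealSubfield L)) L (IsCMField.complexConj L) 2
          (Matrix.of fun i j : Fin 2 => if i.val + j.val + 1 = 2 then (1 : L) else 0) ×
        UnitaryGroup.arch (↥(maximalRealSubfield L)) L (IsCMField.complexConj L) 1
          (Matrix.of fun i j : Fin 1 => if i.val + j.val + 1 = 1 then (1 : L) else 0)) → ℂ)
        (a : UnitaryGroup.arch (↥(maximalRealSubfield L)) L (IsCMField.complexConj L) 3 H' → ℂ),
        ArchSmooth L 3 H' a → ArchSmooth₂ L aH → IsArchDeltaTransfer L H' T mHi m' aH a → F a = cinf * aH x₀ :=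
  kappaTransport_of_delta_eq_classFun_mul ψ ρ hρc (fun a b ha hb => hρs a b ha hb) hρψ (fun a b ha => hT a b ha)
    (ArchSmooth L 3 H') (ArchSmooth₂ L) hTinfty F hx₀ h₁ h

/-- **SOCKET #21 MODULO THE TWIST DATA AND (T∞)** — `sig_K2E4WeakMatrixArchTransport`'s implication `(Hcan) → (Hweak)` with its functional (`Φ^st(γ₀ ⊗ 1, a)` against
★ `archSingularTopFormFamily L H′ νGi`) and its point `γ_H ⊗ 1` VERBATIM, when the weak `Tinf` is a class-function twist `ψ · Δ‴_∞(μ)` on the `G`-regular pairs with an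
inverse multiplier `ρ` as in §1 that does not vanish at `γ_H ⊗ 1`, and (T∞) holds for `ρ`.  The constant moves by `ρ(γ_H ⊗ 1)`.  The rigidity «every admissible weak
`Tinf` is such a twist» and the lemma (T∞) are NOT claimed here. [cite: Rogawski1990, Prop. 8.2.1 (a) p. 118; §14.3 pp. 233–234; §14.6 p. 242] -/
theorem weakMatrixArchTransport_of_twist
    [MeasurableSpace (UnitaryGroup.arch (↥(maximalRealSubfield L)) L (IsCMField.complexConj L) 3 H')]
    [BorelSpace (UnitaryGroup.arch (↥(maximalRealSubfield L)) L (IsCMField.complexConj L) 3 H')]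
    [∀ γ : UnitaryGroup.arch (↥(maximalRealSubfield L)) L (IsCMField.complexConj L) 3 H',
      MeasurableSpace (UnitaryGroup.arch (↥(maximalRealSubfield L)) L (IsCMField.complexConj L) 3 H' ⧸
        Subgroup.centralizer ({γ} : Set (UnitaryGroup.arch (↥(maximalRealSubfield L)) L (IsCMField.complexConj L) 3 H')))]
    [∀ γ : UnitaryGroup.arch (↥(maximalRealSubfield L)) L (IsCMField.complexConj L) 3 H',
      BorelSpace (UnitaryGroup.arch (↥(maximalRealSubfield L)) L (IsCMField.complexConj L) 3 H' ⧸
        Subgroup.centralizer ({γ} : Set (UnitaryGroup.arch (↥(maximalRealSubfield L)) L (IsCMField.complexConj L) 3 H')))]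
    [∀ a : (UnitaryGroup.arch (↥(maximalRealSubfield L)) L (IsCMField.complexConj L) 2
          (Matrix.of fun i j : Fin 2 => if i.val + j.val + 1 = 2 then (1 : L) else 0) ×
        UnitaryGroup.arch (↥(maximalRealSubfield L)) L (IsCMField.complexConj L) 1
          (Matrix.of fun i j : Fin 1 => if i.val + j.val + 1 = 1 then (1 : L) else 0)),
      MeasurableSpace ((UnitaryGroup.arch (↥(maximalRealSubfield L)) L (IsCMField.complexConj L) 2
          (Matrix.of fun i j : Fin 2 => if i.val + j.val + 1 = 2 then (1 : L) else 0) ×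
        UnitaryGroup.arch (↥(maximalRealSubfield L)) L (IsCMField.complexConj L) 1
          (Matrix.of fun i j : Fin 1 => if i.val + j.val + 1 = 1 then (1 : L) else 0)) ⧸
        Subgroup.centralizer ({a} : Set (UnitaryGroup.arch (↥(maximalRealSubfield L)) L (IsCMField.complexConj L) 2
          (Matrix.of fun i j : Fin 2 => if i.val + j.val + 1 = 2 then (1 : L) else 0) ×
        UnitaryGroup.arch (↥(maximalRealSubfield L)) L (IsCMField.complexConj L) 1
          (Matrix.of fun i j : Fin 1 => if i.val + j.val + 1 = 1 then (1 : L) else 0))))]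
    (Tinf : ArchTransferFactor L H') (νGi : Measure (UnitaryGroup.arch (↥(maximalRealSubfield L)) L (IsCMField.complexConj L) 3 H'))
    [IsFiniteMeasureOnCompacts νGi] [νGi.IsMulRightInvariant]
    (m' : OrbitalMeasureFamily (UnitaryGroup.arch (↥(maximalRealSubfield L)) L (IsCMField.complexConj L) 3 H'))
    (mHi : OrbitalMeasureFamily (UnitaryGroup.arch (↥(maximalRealSubfield L)) L (IsCMField.complexConj L) 2
          (Matrix.of fun i j : Fin 2 => if i.val + j.val + 1 = 2 then (1 : L) else 0) ×
        UnitaryGroup.arch (↥(maximalRealSubfield L)) L (IsCMField.complexConj L) 1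
          (Matrix.of fun i j : Fin 1 => if i.val + j.val + 1 = 1 then (1 : L) else 0)))
    (μ : HeckeCharacter L) (ψ ρ : (UnitaryGroup.arch (↥(maximalRealSubfield L)) L (IsCMField.complexConj L) 2
          (Matrix.of fun i j : Fin 2 => if i.val + j.val + 1 = 2 then (1 : L) else 0) ×
        UnitaryGroup.arch (↥(maximalRealSubfield L)) L (IsCMField.complexConj L) 1
          (Matrix.of fun i j : Fin 1 => if i.val + j.val + 1 = 1 then (1 : L) else 0)) → ℂ)
    (hρc : ∀ g x : (UnitaryGroup.arch (↥(maximalRealSubfield L)) L (IsCMField.complexConj L) 2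
          (Matrix.of fun i j : Fin 2 => if i.val + j.val + 1 = 2 then (1 : L) else 0) ×
        UnitaryGroup.arch (↥(maximalRealSubfield L)) L (IsCMField.complexConj L) 1
          (Matrix.of fun i j : Fin 1 => if i.val + j.val + 1 = 1 then (1 : L) else 0)), ρ (g * x * g⁻¹) = ρ x)
    (hρs : ∀ a b : (UnitaryGroup.arch (↥(maximalRealSubfield L)) L (IsCMField.complexConj L) 2
          (Matrix.of fun i j : Fin 2 => if i.val + j.val + 1 = 2 then (1 : L) else 0) ×
        UnitaryGroup.arch (↥(maximalRealSubfield L)) L (IsCMField.complexConj L) 1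
          (Matrix.of fun i j : Fin 1 => if i.val + j.val + 1 = 1 then (1 : L) else 0)), IsArchGRegular L a → IsArchStablyConjH L a b → ρ b = ρ a)
    (hρψ : ∀ a : (UnitaryGroup.arch (↥(maximalRealSubfield L)) L (IsCMField.complexConj L) 2
          (Matrix.of fun i j : Fin 2 => if i.val + j.val + 1 = 2 then (1 : L) else 0) ×
        UnitaryGroup.arch (↥(maximalRealSubfield L)) L (IsCMField.complexConj L) 1
          (Matrix.of fun i j : Fin 1 => if i.val + j.val + 1 = 1 then (1 : L) else 0)), IsArchGRegular L a → ρ a * ψ a = 1)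
    (htwist : ∀ (γH : (UnitaryGroup.arch (↥(maximalRealSubfield L)) L (IsCMField.complexConj L) 2
          (Matrix.of fun i j : Fin 2 => if i.val + j.val + 1 = 2 then (1 : L) else 0) ×
        UnitaryGroup.arch (↥(maximalRealSubfield L)) L (IsCMField.complexConj L) 1
          (Matrix.of fun i j : Fin 1 => if i.val + j.val + 1 = 1 then (1 : L) else 0)))
        (γ' : UnitaryGroup.arch (↥(maximalRealSubfield L)) L (IsCMField.complexConj L) 3 H'),
        IsArchGRegular L γH → Tinf.Δ γH γ' = ψ γH * (archCanonicalTransferFactor L H' μ).Δ γH γ')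
    (hTinfty : ∀ aH : (UnitaryGroup.arch (↥(maximalRealSubfield L)) L (IsCMField.complexConj L) 2
          (Matrix.of fun i j : Fin 2 => if i.val + j.val + 1 = 2 then (1 : L) else 0) ×
        UnitaryGroup.arch (↥(maximalRealSubfield L)) L (IsCMField.complexConj L) 1
          (Matrix.of fun i j : Fin 1 => if i.val + j.val + 1 = 1 then (1 : L) else 0)) → ℂ, ArchSmooth₂ L aH → ArchSmooth₂ L (fun y => ρ y * aH y))
    (γ₀ : (UnitaryGroup.cmDatum L 3 H').Rational)
    (γH : (UnitaryGroup.cmDatum L 2 (Matrix.of fun i j : Fin 2 => if i.val + j.val + 1 = 2 then (1 : L) else 0)).Rational ×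
      (UnitaryGroup.cmDatum L 1 (Matrix.of fun i j : Fin 1 => if i.val + j.val + 1 = 1 then (1 : L) else 0)).Rational)
    (hx₀ : ρ (cmRationalToArch L 2 (Matrix.of fun i j : Fin 2 => if i.val + j.val + 1 = 2 then (1 : L) else 0) γH.1,
      cmRationalToArch L 1 (Matrix.of fun i j : Fin 1 => if i.val + j.val + 1 = 1 then (1 : L) else 0) γH.2) ≠ 0) :
    (∃ cinf₁ : ℂ, cinf₁ ≠ 0 ∧
      (∀ (aH : UnitaryGroup.arch (↥(maximalRealSubfield L)) L (IsCMField.complexConj L) 2 (Matrix.of fun i j : Fin 2 => if i.val + j.val + 1 = 2 then (1 : L) else 0) ×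
              UnitaryGroup.arch (↥(maximalRealSubfield L)) L (IsCMField.complexConj L) 1 (Matrix.of fun i j : Fin 1 => if i.val + j.val + 1 = 1 then (1 : L) else 0) → ℂ)
            (a : UnitaryGroup.arch (↥(maximalRealSubfield L)) L (IsCMField.complexConj L) 3 H' → ℂ),
          ArchSmooth L 3 H' a → ArchSmooth₂ L aH → IsArchDeltaTransfer L H' (archCanonicalTransferFactor L H' μ) mHi m' aH a →
          archStableOrbitalIntegral L 3 H' (Literature.NumberTheory.Weil1964.UnitaryArchTopForm.archSingularTopFormFamily L H' νGi) a (cmRationalToArch L 3 H' γ₀) =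
            cinf₁ * aH (cmRationalToArch L 2 (Matrix.of fun i j : Fin 2 => if i.val + j.val + 1 = 2 then (1 : L) else 0) γH.1, cmRationalToArch L 1 (Matrix.of fun i j : Fin 1 => if i.val + j.val + 1 = 1 then (1 : L) else 0) γH.2))) →
    ∃ cinf : ℂ, cinf ≠ 0 ∧
      (∀ (aH : UnitaryGroup.arch (↥(maximalRealSubfield L)) L (IsCMField.complexConj L) 2 (Matrix.of fun i j : Fin 2 => if i.val + j.val + 1 = 2 then (1 : L) else 0) ×
              UnitaryGroup.arch (↥(maximalRealSubfield L)) L (IsCMField.complexConj L) 1 (Matrix.of fun i j : Fin 1 => if i.val + j.val + 1 = 1 then (1 : L) else 0) → ℂ)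
            (a : UnitaryGroup.arch (↥(maximalRealSubfield L)) L (IsCMField.complexConj L) 3 H' → ℂ),
          ArchSmooth L 3 H' a → ArchSmooth₂ L aH → IsArchDeltaTransfer L H' Tinf mHi m' aH a →
          archStableOrbitalIntegral L 3 H' (Literature.NumberTheory.Weil1964.UnitaryArchTopForm.archSingularTopFormFamily L H' νGi) a (cmRationalToArch L 3 H' γ₀) =
            cinf * aH (cmRationalToArch L 2 (Matrix.of fun i j : Fin 2 => if i.val + j.val + 1 = 2 then (1 : L) else 0) γH.1, cmRationalToArch L 1 (Matrix.of fun i j : Fin 1 => if i.val + j.val + 1 = 1 then (1 : L) else 0) γH.2)) := by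
  rintro ⟨cinf₁, h₁, h⟩
  exact archKappaTransport_of_delta_eq_classFun_mul L H' ψ ρ hρc hρs hρψ htwist hTinfty mHi m' _ hx₀ h₁ h

end Arch

/-! ## §3 At a finite place `v`: (T_v) is a theorem for locally constant `ρ` -/

section Fin

variable (L : Type) [Field L] [NumberField L] [IsCMField L] (H' : Matrix (Fin 3) (Fin 3) L) (v : HeightOneSpectrum (𝓞 ↥(maximalRealSubfield L)))

/-- **κ-TRANSPORT under a locally constant class-function twist at a finite place** (any functional ∕ point): local transfer factors `T, T′` at `v` with
`T.Δ(γ_H, γ) = ψ(γ_H) · T′.Δ(γ_H, γ)` at the `G`-regular `γ_H ∈ H_v`; `ρ` LOCALLY CONSTANT, conjugation-invariant, constant on the stable classes (★ `IsLocalStablyConjH`) of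
`G`-regular elements, `ρ · ψ = 1` there, `ρ(x₀) ≠ 0`.  Then (κ-loc)_v[T′, cv₁] ⟹ (κ-loc)_v[T, cv₁ · ρ(x₀)] — (T_v) «`C_c^∞(H_v)` is closed under `f^H ↦ ρ · f^H`» is discharged here
(`IsLocSmooth` = locally constant ∧ compactly supported). [cite: Rogawski1990, §4.3 (4.3.1) p. 43; §4.9 Prop. 4.9.1 (a) p. 55; Prop. 8.2.1 (a) p. 118] -/
theorem finKappaTransport_of_delta_eq_classFun_mul
    {_ha : ∀ a : ((UnitaryGroup.cmDatum L 2 (Matrix.of fun i j : Fin 2 => if i.val + j.val + 1 = 2 then (1 : L) else 0)).Local v ×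
        (UnitaryGroup.cmDatum L 1 (Matrix.of fun i j : Fin 1 => if i.val + j.val + 1 = 1 then (1 : L) else 0)).Local v),
      MeasurableSpace (((UnitaryGroup.cmDatum L 2 (Matrix.of fun i j : Fin 2 => if i.val + j.val + 1 = 2 then (1 : L) else 0)).Local v ×
        (UnitaryGroup.cmDatum L 1 (Matrix.of fun i j : Fin 1 => if i.val + j.val + 1 = 1 then (1 : L) else 0)).Local v) ⧸
        Subgroup.centralizer ({a} : Set ((UnitaryGroup.cmDatum L 2 (Matrix.of fun i j : Fin 2 => if i.val + j.val + 1 = 2 then (1 : L) else 0)).Local v ×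
        (UnitaryGroup.cmDatum L 1 (Matrix.of fun i j : Fin 1 => if i.val + j.val + 1 = 1 then (1 : L) else 0)).Local v)))}
    {_hγ : ∀ γ : (UnitaryGroup.cmDatum L 3 H').Local v,
      MeasurableSpace ((UnitaryGroup.cmDatum L 3 H').Local v ⧸ Subgroup.centralizer ({γ} : Set ((UnitaryGroup.cmDatum L 3 H').Local v)))}
    {T T' : LocalTransferFactor L H' v} (ψ ρ : ((UnitaryGroup.cmDatum L 2 (Matrix.of fun i j : Fin 2 => if i.val + j.val + 1 = 2 then (1 : L) else 0)).Local v ×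
        (UnitaryGroup.cmDatum L 1 (Matrix.of fun i j : Fin 1 => if i.val + j.val + 1 = 1 then (1 : L) else 0)).Local v) → ℂ)
    (hρl : IsLocallyConstant ρ) (hρc : ∀ g x : ((UnitaryGroup.cmDatum L 2 (Matrix.of fun i j : Fin 2 => if i.val + j.val + 1 = 2 then (1 : L) else 0)).Local v ×
        (UnitaryGroup.cmDatum L 1 (Matrix.of fun i j : Fin 1 => if i.val + j.val + 1 = 1 then (1 : L) else 0)).Local v), ρ (g * x * g⁻¹) = ρ x)
    (hρs : ∀ a b : ((UnitaryGroup.cmDatum L 2 (Matrix.of fun i j : Fin 2 => if i.val + j.val + 1 = 2 then (1 : L) else 0)).Local v ×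
        (UnitaryGroup.cmDatum L 1 (Matrix.of fun i j : Fin 1 => if i.val + j.val + 1 = 1 then (1 : L) else 0)).Local v), IsLocalGRegular L v a → IsLocalStablyConjH L v a b → ρ b = ρ a)
    (hρψ : ∀ a : ((UnitaryGroup.cmDatum L 2 (Matrix.of fun i j : Fin 2 => if i.val + j.val + 1 = 2 then (1 : L) else 0)).Local v ×
        (UnitaryGroup.cmDatum L 1 (Matrix.of fun i j : Fin 1 => if i.val + j.val + 1 = 1 then (1 : L) else 0)).Local v), IsLocalGRegular L v a → ρ a * ψ a = 1)
    (hT : ∀ (γH : ((UnitaryGroup.cmDatum L 2 (Matrix.of fun i j : Fin 2 => if i.val + j.val + 1 = 2 then (1 : L) else 0)).Local v ×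
        (UnitaryGroup.cmDatum L 1 (Matrix.of fun i j : Fin 1 => if i.val + j.val + 1 = 1 then (1 : L) else 0)).Local v))
        (γ : (UnitaryGroup.cmDatum L 3 H').Local v), IsLocalGRegular L v γH → T.Δ γH γ = ψ γH * T'.Δ γH γ)
    (mH : OrbitalMeasureFamily ((UnitaryGroup.cmDatum L 2 (Matrix.of fun i j : Fin 2 => if i.val + j.val + 1 = 2 then (1 : L) else 0)).Local v ×
        (UnitaryGroup.cmDatum L 1 (Matrix.of fun i j : Fin 1 => if i.val + j.val + 1 = 1 then (1 : L) else 0)).Local v))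
    (mG : OrbitalMeasureFamily ((UnitaryGroup.cmDatum L 3 H').Local v))
    (F : ((UnitaryGroup.cmDatum L 3 H').Local v → ℂ) → ℂ)
    {x₀ : ((UnitaryGroup.cmDatum L 2 (Matrix.of fun i j : Fin 2 => if i.val + j.val + 1 = 2 then (1 : L) else 0)).Local v ×
        (UnitaryGroup.cmDatum L 1 (Matrix.of fun i j : Fin 1 => if i.val + j.val + 1 = 1 then (1 : L) else 0)).Local v)} (hx₀ : ρ x₀ ≠ 0) {cv₁ : ℂ} (h₁ : cv₁ ≠ 0)
    (h : ∀ (fH : ((UnitaryGroup.cmDatum L 2 (Matrix.of fun i j : Fin 2 => if i.val + j.val + 1 = 2 then (1 : L) else 0)).Local v ×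
        (UnitaryGroup.cmDatum L 1 (Matrix.of fun i j : Fin 1 => if i.val + j.val + 1 = 1 then (1 : L) else 0)).Local v) → ℂ)
        (f : (UnitaryGroup.cmDatum L 3 H').Local v → ℂ),
        IsLocSmooth f → IsLocSmooth fH → IsLocalDeltaTransfer L H' v T' mH mG fH f → F f = cv₁ * fH x₀) :
    ∃ cv : ℂ, cv ≠ 0 ∧
      ∀ (fH : ((UnitaryGroup.cmDatum L 2 (Matrix.of fun i j : Fin 2 => if i.val + j.val + 1 = 2 then (1 : L) else 0)).Local v ×
        (UnitaryGroup.cmDatum L 1 (Matrix.of fun i j : Fin 1 => if i.val + j.val + 1 = 1 then (1 : L) else 0)).Local v) → ℂ)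
        (f : (UnitaryGroup.cmDatum L 3 H').Local v → ℂ),
        IsLocSmooth f → IsLocSmooth fH → IsLocalDeltaTransfer L H' v T mH mG fH f → F f = cv * fH x₀ :=
  kappaTransport_of_delta_eq_classFun_mul ψ ρ hρc (fun a b ha hb => hρs a b ha hb) hρψ (fun a b ha => hT a b ha)
    IsLocSmooth IsLocSmooth (fun _ hfH => ⟨hρl.mul hfH.isLocallyConstant, hfH.hasCompactSupport.mul_left⟩) F hx₀ h₁ h

/-- **SOCKET #22 MODULO THE TWIST DATA** — `sig_K2E4WeakMatrixFiniteTransport`'s per-place implication with its functional (`Φ^st((γ₀)_v, f)` of the singular family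
`mGs₀ v`) and its point `(γ_H)_v` VERBATIM (families read at the fixed `v`), when the weak `Δ v` is a locally-constant class-function twist `ψ · Δ‴_v` on the `G`-regular
pairs with an inverse multiplier `ρ` as in §3 that does not vanish at `(γ_H)_v`.  The constant moves by `ρ((γ_H)_v)`; (T_v) is discharged.  The rigidity «every admissible
weak `Δ v` is such a twist» is NOT claimed here. [cite: Rogawski1990, Prop. 8.2.1 (a) p. 118; §4.9 Prop. 4.9.1 (a) p. 55; §14.6 p. 242] -/
theorem weakMatrixFiniteTransport_of_twist
    {_ha : ∀ a : ((UnitaryGroup.cmDatum L 2 (Matrix.of fun i j : Fin 2 => if i.val + j.val + 1 = 2 then (1 : L) else 0)).Local v ×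
        (UnitaryGroup.cmDatum L 1 (Matrix.of fun i j : Fin 1 => if i.val + j.val + 1 = 1 then (1 : L) else 0)).Local v),
      MeasurableSpace (((UnitaryGroup.cmDatum L 2 (Matrix.of fun i j : Fin 2 => if i.val + j.val + 1 = 2 then (1 : L) else 0)).Local v ×
        (UnitaryGroup.cmDatum L 1 (Matrix.of fun i j : Fin 1 => if i.val + j.val + 1 = 1 then (1 : L) else 0)).Local v) ⧸
        Subgroup.centralizer ({a} : Set ((UnitaryGroup.cmDatum L 2 (Matrix.of fun i j : Fin 2 => if i.val + j.val + 1 = 2 then (1 : L) else 0)).Local v ×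
        (UnitaryGroup.cmDatum L 1 (Matrix.of fun i j : Fin 1 => if i.val + j.val + 1 = 1 then (1 : L) else 0)).Local v)))}
    {_hγ : ∀ γ : (UnitaryGroup.cmDatum L 3 H').Local v,
      MeasurableSpace ((UnitaryGroup.cmDatum L 3 H').Local v ⧸ Subgroup.centralizer ({γ} : Set ((UnitaryGroup.cmDatum L 3 H').Local v)))}
    (Δv : LocalTransferFactor L H' v)
    (mHv : OrbitalMeasureFamily ((UnitaryGroup.cmDatum L 2 (Matrix.of fun i j : Fin 2 => if i.val + j.val + 1 = 2 then (1 : L) else 0)).Local v ×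
        (UnitaryGroup.cmDatum L 1 (Matrix.of fun i j : Fin 1 => if i.val + j.val + 1 = 1 then (1 : L) else 0)).Local v))
    (mGv mGs₀v : OrbitalMeasureFamily ((UnitaryGroup.cmDatum L 3 H').Local v))
    (μ : HeckeCharacter L) (ψ ρ : ((UnitaryGroup.cmDatum L 2 (Matrix.of fun i j : Fin 2 => if i.val + j.val + 1 = 2 then (1 : L) else 0)).Local v ×
        (UnitaryGroup.cmDatum L 1 (Matrix.of fun i j : Fin 1 => if i.val + j.val + 1 = 1 then (1 : L) else 0)).Local v) → ℂ)
    (hρl : IsLocallyConstant ρ) (hρc : ∀ g x : ((UnitaryGroup.cmDatum L 2 (Matrix.of fun i j : Fin 2 => if i.val + j.val + 1 = 2 then (1 : L) else 0)).Local v ×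
        (UnitaryGroup.cmDatum L 1 (Matrix.of fun i j : Fin 1 => if i.val + j.val + 1 = 1 then (1 : L) else 0)).Local v), ρ (g * x * g⁻¹) = ρ x)
    (hρs : ∀ a b : ((UnitaryGroup.cmDatum L 2 (Matrix.of fun i j : Fin 2 => if i.val + j.val + 1 = 2 then (1 : L) else 0)).Local v ×
        (UnitaryGroup.cmDatum L 1 (Matrix.of fun i j : Fin 1 => if i.val + j.val + 1 = 1 then (1 : L) else 0)).Local v), IsLocalGRegular L v a → IsLocalStablyConjH L v a b → ρ b = ρ a)
    (hρψ : ∀ a : ((UnitaryGroup.cmDatum L 2 (Matrix.of fun i j : Fin 2 => if i.val + j.val + 1 = 2 then (1 : L) else 0)).Local v ×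
        (UnitaryGroup.cmDatum L 1 (Matrix.of fun i j : Fin 1 => if i.val + j.val + 1 = 1 then (1 : L) else 0)).Local v), IsLocalGRegular L v a → ρ a * ψ a = 1)
    (htwist : ∀ (γH : ((UnitaryGroup.cmDatum L 2 (Matrix.of fun i j : Fin 2 => if i.val + j.val + 1 = 2 then (1 : L) else 0)).Local v ×
        (UnitaryGroup.cmDatum L 1 (Matrix.of fun i j : Fin 1 => if i.val + j.val + 1 = 1 then (1 : L) else 0)).Local v))
        (γ : (UnitaryGroup.cmDatum L 3 H').Local v), IsLocalGRegular L v γH →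
        Δv.Δ γH γ = ψ γH * (finExplicitCollection L H' μ (finExplicitDelta_conj_left_all L H' μ) (finExplicitDelta_conj_right_all L H' μ) v).Δ γH γ)
    (γ₀ : (UnitaryGroup.cmDatum L 3 H').Rational)
    (γH : (UnitaryGroup.cmDatum L 2 (Matrix.of fun i j : Fin 2 => if i.val + j.val + 1 = 2 then (1 : L) else 0)).Rational ×
      (UnitaryGroup.cmDatum L 1 (Matrix.of fun i j : Fin 1 => if i.val + j.val + 1 = 1 then (1 : L) else 0)).Rational)
    (hx₀ : ρ ((UnitaryGroup.cmDatum L 2 (Matrix.of fun i j : Fin 2 => if i.val + j.val + 1 = 2 then (1 : L) else 0)).toLocal v ((UnitaryGroup.cmDatum L 2 (Matrix.of fun i j : Fin 2 => if i.val + j.val + 1 = 2 then (1 : L) else 0)).toAdelic γH.1),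
      (UnitaryGroup.cmDatum L 1 (Matrix.of fun i j : Fin 1 => if i.val + j.val + 1 = 1 then (1 : L) else 0)).toLocal v ((UnitaryGroup.cmDatum L 1 (Matrix.of fun i j : Fin 1 => if i.val + j.val + 1 = 1 then (1 : L) else 0)).toAdelic γH.2)) ≠ 0) :
    (∃ cv : ℂ, cv ≠ 0 ∧ ∀
          (fH : (UnitaryGroup.cmDatum L 2 (Matrix.of fun i j : Fin 2 => if i.val + j.val + 1 = 2 then (1 : L) else 0)).Local v × (UnitaryGroup.cmDatum L 1 (Matrix.of fun i j : Fin 1 => if i.val + j.val + 1 = 1 then (1 : L) else 0)).Local v → ℂ) (f : (UnitaryGroup.cmDatum L 3 H').Local v → ℂ),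
        IsLocSmooth f → IsLocSmooth fH → IsLocalDeltaTransfer L H' v (finExplicitCollection L H' μ (finExplicitDelta_conj_left_all L H' μ) (finExplicitDelta_conj_right_all L H' μ) v) mHv mGv fH f →
        localStableOrbitalIntegral L 3 H' v mGs₀v f ((UnitaryGroup.cmDatum L 3 H').toLocal v ((UnitaryGroup.cmDatum L 3 H').toAdelic γ₀)) =
          cv * fH ((UnitaryGroup.cmDatum L 2 (Matrix.of fun i j : Fin 2 => if i.val + j.val + 1 = 2 then (1 : L) else 0)).toLocal v ((UnitaryGroup.cmDatum L 2 (Matrix.of fun i j : Fin 2 => if i.val + j.val + 1 = 2 then (1 : L) else 0)).toAdelic γH.1),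
            (UnitaryGroup.cmDatum L 1 (Matrix.of fun i j : Fin 1 => if i.val + j.val + 1 = 1 then (1 : L) else 0)).toLocal v ((UnitaryGroup.cmDatum L 1 (Matrix.of fun i j : Fin 1 => if i.val + j.val + 1 = 1 then (1 : L) else 0)).toAdelic γH.2))) →
    ∃ cv : ℂ, cv ≠ 0 ∧ ∀
          (fH : (UnitaryGroup.cmDatum L 2 (Matrix.of fun i j : Fin 2 => if i.val + j.val + 1 = 2 then (1 : L) else 0)).Local v × (UnitaryGroup.cmDatum L 1 (Matrix.of fun i j : Fin 1 => if i.val + j.val + 1 = 1 then (1 : L) else 0)).Local v → ℂ) (f : (UnitaryGroup.cmDatum L 3 H').Local v → ℂ),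
        IsLocSmooth f → IsLocSmooth fH → IsLocalDeltaTransfer L H' v Δv mHv mGv fH f →
        localStableOrbitalIntegral L 3 H' v mGs₀v f ((UnitaryGroup.cmDatum L 3 H').toLocal v ((UnitaryGroup.cmDatum L 3 H').toAdelic γ₀)) =
          cv * fH ((UnitaryGroup.cmDatum L 2 (Matrix.of fun i j : Fin 2 => if i.val + j.val + 1 = 2 then (1 : L) else 0)).toLocal v ((UnitaryGroup.cmDatum L 2 (Matrix.of fun i j : Fin 2 => if i.val + j.val + 1 = 2 then (1 : L) else 0)).toAdelic γH.1),
            (UnitaryGroup.cmDatum L 1 (Matrix.of fun i j : Fin 1 => if i.val + j.val + 1 = 1 then (1 : L) else 0)).toLocal v ((UnitaryGroup.cmDatum L 1 (Matrix.of fun i j : Fin 1 => if i.val + j.val + 1 = 1 then (1 : L) else 0)).toAdelic γH.2)) := by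
  rintro ⟨cv₁, h₁, h⟩
  exact finKappaTransport_of_delta_eq_classFun_mul L H' v ψ ρ hρl hρc hρs hρψ htwist mHv mGv _ hx₀ h₁ h

end Fin

end Summit.HodgeConjecture.HodgeConjecture.Cruxes.H413.K2E4WeakMatrixTransportOfTwist

end
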